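import Summits.AtomisticToContinuum.Crystallization.Theorems.ChartedZeroExcessLayeredLatticeLiouvilleUK

/-!
# Zero-excess layered lattice Liouville — part UL (lens-2 g52, node «BondIsoThreading» III/III): the Caccioppoli-side twins [C_Tᵇ] `TameRigidCaccioppoliBPG`,
# [CC°ᵇ] `TameGscCaccioppoliFloorBPG`, [CC°_Wᵇ] `CoherentGscCaccioppoliBPG`, every seam re-proved with the clause handed along, and the lines down to (Mᵇ):
# `(Mᵇ) ⟸ Gehring-leaf ∧ [I_D] ∧ [T_bᵇ] ∧ [KS] ∧ [W] ∧ [CC°_Wᵇ]` (PROVED)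

Continuation of parts UJ, UK (insertion rule, reason and tags: module docstrings of parts UI, UJ).  Contents:
§ZL.1 [C_Tᵇ]: `[C_T] ⇒ [C_Tᵇ]`, `[Cᵇ] ⇒ [C_Tᵇ]`, the dichotomy seam `[Tᵇ] ∧ [C_Tᵇ] ⇒ [Cᵇ]` (part UC's proof), and `[T] ∧ [C_Tᵇ] ⇒ [Cᵇ]` (every cut of
parts UE–UH as typed still closes the re-typed tame line).
§ZL.2 [CC°ᵇ]: `[CC°] ⇒ [CC°ᵇ]` and the mechanism seam `[KS] ∧ [CC°ᵇ] ⇒ [C_Tᵇ]` (part UD's proof, small-ball branch included; [KS] `KornSobolevPoincareP` is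
energy-free and untouched).  The unfloored [CC] `TameGscCaccioppoliPG`, superseded by [CC°] in part UD, is not re-typed.
§ZL.3 [CC°_Wᵇ]: `[CC°_W] ⇒ [CC°_Wᵇ]`, `[CC°ᵇ] ⇒ [CC°_Wᵇ]`, the basin seam `[W] ∧ [CC°_Wᵇ] ⇒ [CC°ᵇ]` (part UD's proof; [W] `CoherentWindowPG` untouched).
§ZL.4 the lines down to [Cᵇ] and (Mᵇ) (`aHi ≤ 8/7`, Gehring leaf): tame, coherent, dressed-core, clamped-core; the DOCKET OF RECORD at the literals
`(aHi; Λ, θ, s; ϑ; ϑe, ωe, p, r₀, ℓ, M) = (1; 2, 1/16, 1/50; tameRadius; dressLevel, dressLevel, dressExponent, 8, collarRadius, clusterSize)` as a named theorem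
(`strainNonConcentrationBPG_1_50_of_docket`, the leaf (Mᵇ) of part UI's `gap_and_pert_1_50_of_certs_16XH19B(_tol)`), and «the old docket ⇒ the new leaf».
No `sorry`, no new axiom, no instance / notation; no literature claim beyond those of parts UC, UD, UG, UH.
-/

noncomputable section

open scoped BigOperators
open MeasureTheory Set Metric Filter Topology
open Summit.AtomisticToContinuum.Crystallization.Theorems.ChartedPlanarOrderRigidityDoor (E3 atomsIn)
open Summit.AtomisticToContinuum.Crystallization.Theorems.ChartedPlanarOrderDensityDichotomy (μS IsSep nK nK_nonneg)
open Summit.AtomisticToContinuum.Crystallization.Theorems.ChartedPlanarOrderCleanScaleP (IsCleanP IsDoorSetP)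
open Summit.AtomisticToContinuum.Crystallization.Theorems.ChartedPlanarOrderMesoCut (LayeredHom EnvClose)
open Summit.AtomisticToContinuum.Crystallization.Theorems.ChartedPlanarOrderDoorLayered (atomsIn_subset)
open Summit.AtomisticToContinuum.Crystallization.Theorems.ChartedPlanarOrderDoorLayeredOsc (IsTwoShellAffineGood)
open Literature.Analysis.PDE (finavg ZatorskaGoldstein2005_localGehringLemmaCounting)

namespace Summit.AtomisticToContinuum.Crystallization.Theorems.ChartedZeroExcessLayeredLatticeLiouville

/-! ### ZL.1  [C_Tᵇ] «TameRigidCaccioppoliBPG» and the dichotomy seam `[Tᵇ] ∧ [C_Tᵇ] ⇒ [Cᵇ]` -/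

/-- ★★ **[C_Tᵇ] «TameRigidCaccioppoliBPG ϑ aHi Λ θ s»** — [C_T] `TameRigidCaccioppoliPG` (part UC: [C] on TAME windows) VERBATIM with the extra hypothesis
`IsBondIso S Ψ`; conclusion unchanged.  WEAKER than [C_T] and than [Cᵇ] (PROVED); `[Tᵇ] ∧ [C_Tᵇ] ⇒ [Cᵇ]` (`rigidCaccioppoliBPG_of_tame`) and
`[KS] ∧ [CC°ᵇ] ⇒ [C_Tᵇ]` (§ZL.2) PROVED.  MECHANISM-KNOWN-type (Giaquinta–Modica) · GSC-priced · UNDECIDED · ATTACKABLE·XL through [CC°ᵇ].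
Why it might fail: as [C_T] (mesoscopically bent tame balls; termination of the hole filling at the lattice collar width); not through faulted charts.
Sources: part UC ([C_T]: [giaquinta1984 Ch. V §2, Ch. IX]; Giusti in [hildebrandt1988 pp. 85–86]); parts TG, UI. [this file, g52] -/
def TameRigidCaccioppoliBPG (ϑ aHi Λ θ s : ℝ) : Prop :=
  ∀ δ : ℝ, 0 < δ → ∀ a : ℝ, 0 < a → ∀ Cg : ℝ, 1 ≤ Cg → ∃ Cg' : ℝ, Cg ≤ Cg' ∧
    ∃ b : ℝ, 0 < b ∧ ∃ d : ℝ, 0 < d ∧ d < 1 ∧ ∃ A : ℝ, 0 ≤ A ∧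
    ∀ K₀ : ℝ, 0 < K₀ → ∃ η₁ : ℝ, 0 < η₁ ∧ ∃ R₁ : ℝ, 0 < R₁ ∧
      ∀ S : Set E3, IsDoorSetPG aHi δ S → (∀ q ∈ S, IsTwoShellAffineGood θ S q) →
        ∀ η : ℝ, 0 < η → η ≤ η₁ → ∀ R : ℝ, R₁ ≤ R →
          ∀ (L : E3 ≃L[ℝ] E3) (w : ℤ → E3), IsEquilChart a s Λ L w →
            ∀ Ψ : E3 → E3, IsGlobalReg Cg η R S (LayeredHom (L : E3 →L[ℝ] E3) w) Ψ → IsBondIso S Ψ →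
              K₀ ≤ η * nK (atomsIn (μS S) 0 R) →
                IsTameOn ϑ S (LayeredHom (L : E3 →L[ℝ] E3) w) (atomsIn (μS S) 0 (9 * R)) →
                ∃ Ψ' : E3 → E3, IsGlobalReg Cg' η R S (LayeredHom (L : E3 →L[ℝ] E3) w) Ψ' ∧
                  ∃ (Q : E3 → (E3 ≃ₗᵢ[ℝ] E3)) (σ : E3 → ℝ), IsTiltStrainData S (8 * R) Ψ' Q σ ∧
                    (∑ᶠ x ∈ atomsIn (μS S) 0 (8 * R), σ x ^ 2) ≤ A * η * nK (atomsIn (μS S) 0 (8 * R)) ∧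
                    ∀ x ∈ S, ∀ r : ℝ, 0 < r → S ∩ ball x (2 * r) ⊆ ball 0 (8 * R) →
                      finavg (S ∩ ball x r) (fun y => σ y ^ 2) ≤
                        b * ((finavg (S ∩ ball x (2 * r)) (fun y => (σ y ^ 2) ^ d)) ^ (1 / d) + A * η)

/-- **[C_T] ⇒ [C_Tᵇ] (PROVED)** — one more hypothesis. [this file, g52] -/
theorem tameRigidCaccioppoliBPG_of_tameRigidCaccioppoliPG {ϑ aHi Λ θ s : ℝ} (h : TameRigidCaccioppoliPG ϑ aHi Λ θ s) :
    TameRigidCaccioppoliBPG ϑ aHi Λ θ s := by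
  intro δ hδ a ha Cg hCg
  obtain ⟨Cg', hCg', b, hb, d, hd0, hd1, A, hA, hK⟩ := h δ hδ a ha Cg hCg
  refine ⟨Cg', hCg', b, hb, d, hd0, hd1, A, hA, fun K₀ hK₀ => ?_⟩
  obtain ⟨η₁, hη₁, R₁, hR₁, h1⟩ := hK K₀ hK₀
  exact ⟨η₁, hη₁, R₁, hR₁, fun S hS hgood η hη hηle R hR L w hLw Ψ hΨ _ hfat htame =>
    h1 S hS hgood η hη hηle R hR L w hLw Ψ hΨ hfat htame⟩

/-- **[Cᵇ] ⇒ [C_Tᵇ] (PROVED)** — the tame side is WEAKER than [Cᵇ] (the tameness hypothesis is not used). [this file, g52] -/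
theorem tameRigidCaccioppoliBPG_of_rigidCaccioppoliBPG {ϑ aHi Λ θ s : ℝ} (h : RigidCaccioppoliBPG aHi Λ θ s) :
    TameRigidCaccioppoliBPG ϑ aHi Λ θ s := by
  intro δ hδ a ha Cg hCg
  obtain ⟨Cg', hCg', b, hb, d, hd0, hd1, A, hA, hK⟩ := h δ hδ a ha Cg hCg
  refine ⟨Cg', hCg', b, hb, d, hd0, hd1, A, hA, fun K₀ hK₀ => ?_⟩
  obtain ⟨η₁, hη₁, R₁, hR₁, h1⟩ := hK K₀ hK₀
  exact ⟨η₁, hη₁, R₁, hR₁, fun S hS hgood η hη hηle R hR L w hLw Ψ hΨ hBI hfat _ =>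
    h1 S hS hgood η hη hηle R hR L w hLw Ψ hΨ hBI hfat⟩

/-- ★★★ **SEAM (PROVED): `[Tᵇ] ∧ [C_Tᵇ] ⇒ [Cᵇ]`** — part UC's `rigidCaccioppoliPG_of_tame` (the dichotomy is exhaustive: a fat near-flat window registered by a
bond isomorphism is tame by [Tᵇ], then [C_Tᵇ] applies), the clause handed to both pieces; thresholds `min/max`, constants those of [C_Tᵇ]. [this file, g52] -/
theorem rigidCaccioppoliBPG_of_tame {ϑ aHi Λ θ s : ℝ} (hT : TameWindowBPG ϑ aHi Λ θ s) (hC : TameRigidCaccioppoliBPG ϑ aHi Λ θ s) :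
    RigidCaccioppoliBPG aHi Λ θ s := by
  intro δ hδ a ha Cg hCg
  obtain ⟨Cg', hCg', b, hb, d, hd0, hd1, A, hA, hK⟩ := hC δ hδ a ha Cg hCg
  refine ⟨Cg', hCg', b, hb, d, hd0, hd1, A, hA, fun K₀ hK₀ => ?_⟩
  obtain ⟨η₁, hη₁, R₁, hR₁, h1⟩ := hT δ hδ a ha Cg hCg K₀ hK₀
  obtain ⟨η₁', hη₁', R₁', hR₁', h2⟩ := hK K₀ hK₀
  refine ⟨min η₁ η₁', lt_min hη₁ hη₁', max R₁ R₁', lt_max_of_lt_left hR₁, ?_⟩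
  intro S hS hgood η hη hηle R hR L w hLw Ψ hΨ hBI hfat
  exact h2 S hS hgood η hη (hηle.trans (min_le_right _ _)) R ((le_max_right _ _).trans hR) L w hLw Ψ hΨ hBI hfat
    (h1 S hS hgood η hη (hηle.trans (min_le_left _ _)) R ((le_max_left _ _).trans hR) L w hLw Ψ hΨ hBI hfat)

/-- **[T] ∧ [C_Tᵇ] ⇒ [Cᵇ] (PROVED)** — the old [T] (hence every cut of parts UE–UH as typed) still closes the re-typed tame line. [this file, g52] -/
theorem rigidCaccioppoliBPG_of_tameWindowPG {ϑ aHi Λ θ s : ℝ} (hT : TameWindowPG ϑ aHi Λ θ s) (hC : TameRigidCaccioppoliBPG ϑ aHi Λ θ s) :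
    RigidCaccioppoliBPG aHi Λ θ s :=
  rigidCaccioppoliBPG_of_tame (tameWindowBPG_of_tameWindowPG hT) hC

/-! ### ZL.2  [CC°ᵇ] «TameGscCaccioppoliFloorBPG» and the mechanism seam `[KS] ∧ [CC°ᵇ] ⇒ [C_Tᵇ]` -/

/-- ★★ **[CC°ᵇ] «TameGscCaccioppoliFloorBPG ϑ aHi Λ θ s»** — [CC°] `TameGscCaccioppoliFloorPG` (part UD: the e⋆-GSC Caccioppoli inequality modulo nearby rigid
motions with background floor and radius floor, on tame windows) VERBATIM with the extra hypothesis `IsBondIso S Ψ`; conclusion unchanged.  WEAKER than [CC°]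
(PROVED); `[KS] ∧ [CC°ᵇ] ⇒ [C_Tᵇ]` PROVED (part UD's proof); cut `[CC°ᵇ] ⟸ [W] ∧ [CC°_Wᵇ]` (§ZL.3).  MECHANISM · GSC-priced · UNDECIDED · INSTRUMENTABLE
((F2) «CaccioppoliRatioScan»).  Why it might fail: as [CC°] (last hole-free step from single-site force balance where strain / rotation are only
mean-square small; Chebyshev-bad collar atoms at `|e⋆|` each); not through faulted charts.
Sources: part UD ([CC°]: Giaquinta–Modica 1979; [giaquinta1984 Ch. V Lemma 3.1, Ch. IX]; Giusti in [hildebrandt1988 pp. 85–86]; Evans 1986; E–Ming 2007);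
parts TG, UI. [this file, g52] -/
def TameGscCaccioppoliFloorBPG (ϑ aHi Λ θ s : ℝ) : Prop :=
  ∀ δ : ℝ, 0 < δ → ∀ a : ℝ, 0 < a → ∀ Cg : ℝ, 1 ≤ Cg → ∃ Cg' : ℝ, Cg ≤ Cg' ∧
    ∃ c₁ : ℝ, 0 < c₁ ∧ ∃ κ : ℝ, 0 < κ ∧ ∃ A : ℝ, 0 ≤ A ∧ ∃ r₀ : ℝ, 0 < r₀ ∧
    ∀ K₀ : ℝ, 0 < K₀ → ∃ η₁ : ℝ, 0 < η₁ ∧ ∃ R₁ : ℝ, 0 < R₁ ∧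
      ∀ S : Set E3, IsDoorSetPG aHi δ S → (∀ q ∈ S, IsTwoShellAffineGood θ S q) →
        ∀ η : ℝ, 0 < η → η ≤ η₁ → ∀ R : ℝ, R₁ ≤ R →
          ∀ (L : E3 ≃L[ℝ] E3) (w : ℤ → E3), IsEquilChart a s Λ L w →
            ∀ Ψ : E3 → E3, IsGlobalReg Cg η R S (LayeredHom (L : E3 →L[ℝ] E3) w) Ψ → IsBondIso S Ψ →
              K₀ ≤ η * nK (atomsIn (μS S) 0 R) →
                IsTameOn ϑ S (LayeredHom (L : E3 →L[ℝ] E3) w) (atomsIn (μS S) 0 (9 * R)) →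
                ∃ Ψ' : E3 → E3, IsGlobalReg Cg' η R S (LayeredHom (L : E3 →L[ℝ] E3) w) Ψ' ∧
                  ∃ (Q : E3 → (E3 ≃ₗᵢ[ℝ] E3)) (σ : E3 → ℝ), IsTiltStrainData S (8 * R) Ψ' Q σ ∧ (∀ x, σ x ≤ 12) ∧
                    (∑ᶠ x ∈ atomsIn (μS S) 0 (8 * R), σ x ^ 2) ≤ A * η * nK (atomsIn (μS S) 0 (8 * R)) ∧
                    ∀ x ∈ S, ∀ r : ℝ, 0 < r → r₀ ≤ r → S ∩ ball x (2 * r) ⊆ ball 0 (8 * R) →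
                      ∀ (U : E3 ≃ₗᵢ[ℝ] E3) (v : E3), LinearMap.det (U.toLinearEquiv : E3 →ₗ[ℝ] E3) = 1 →
                        finavg (S ∩ ball x (3 / 2 * r)) (fun p => ‖Ψ' p - (U p + v)‖ ^ 2) ≤ κ * r ^ 2 →
                          finavg (S ∩ ball x r) (fun y => σ y ^ 2) ≤
                            c₁ * (finavg (S ∩ ball x (3 / 2 * r)) (fun p => ‖Ψ' p - (U p + v)‖ ^ 2) / r ^ 2 + A * η)

/-- **[CC°] ⇒ [CC°ᵇ] (PROVED)** — one more hypothesis. [this file, g52] -/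
theorem tameGscCaccioppoliFloorBPG_of_tameGscCaccioppoliFloorPG {ϑ aHi Λ θ s : ℝ} (h : TameGscCaccioppoliFloorPG ϑ aHi Λ θ s) :
    TameGscCaccioppoliFloorBPG ϑ aHi Λ θ s := by
  intro δ hδ a ha Cg hCg
  obtain ⟨Cg', hCg', c₁, hc₁, κ, hκ, A, hA, r₀, hr₀, hK⟩ := h δ hδ a ha Cg hCg
  refine ⟨Cg', hCg', c₁, hc₁, κ, hκ, A, hA, r₀, hr₀, fun K₀ hK₀ => ?_⟩
  obtain ⟨η₁, hη₁, R₁, hR₁, h1⟩ := hK K₀ hK₀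
  exact ⟨η₁, hη₁, R₁, hR₁, fun S hS hgood η hη hηle R hR L w hLw Ψ hΨ _ hfat htame =>
    h1 S hS hgood η hη hηle R hR L w hLw Ψ hΨ hfat htame⟩

/-- ★★★ **SEAM (PROVED): `[KS] ∧ [CC°ᵇ] ⇒ [C_Tᵇ]`** — part UD's `tameRigidCaccioppoliPG_of_gscCaccioppoliFloor_of_kornSobolev` VERBATIM (LARGE balls
`r ≥ r₀`: [KS] at `ρ := 3r/2`, NEAR ⇒ (ii♭), FAR ⇒ rigidity lower bound against `σ ≤ 12`; SMALL balls: maximum over `B(x, 2r)` and packing; constant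
`b := (9/4)·c₁·C_KS + 324·C_KS/κ + N₀^{1/d}`), the clause handed to [CC°ᵇ]. [this file, g52] -/
theorem tameRigidCaccioppoliBPG_of_gscCaccioppoliFloor_of_kornSobolev {ϑ aHi Λ θ s : ℝ} (hKS : KornSobolevPoincareP aHi θ)
    (hCC : TameGscCaccioppoliFloorBPG ϑ aHi Λ θ s) : TameRigidCaccioppoliBPG ϑ aHi Λ θ s := by
  intro δ hδ a ha Cg hCg
  obtain ⟨CKS, hCKS, d, hd0, hd1, hks⟩ := hKS δ hδ
  obtain ⟨Cg', hCg', c₁, hc₁, κ, hκ, A, hA, r₀, hr₀, hK⟩ := hCC δ hδ a ha Cg hCg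
  have hCKS0 : 0 < CKS := by linarith
  set N₀ : ℝ := (2 * (2 * r₀) / δ + 1) ^ 3 with hN₀def
  have hN₀0 : 0 ≤ N₀ := by positivity
  have hb3 : (0 : ℝ) ≤ N₀ ^ (1 / d) := Real.rpow_nonneg hN₀0 _
  refine ⟨Cg', hCg', 9 / 4 * c₁ * CKS + 324 * CKS / κ + N₀ ^ (1 / d), by positivity, d, hd0, hd1, A, hA, fun K₀ hK₀ => ?_⟩
  obtain ⟨η₁, hη₁, R₁, hR₁, hmain⟩ := hK K₀ hK₀
  refine ⟨η₁, hη₁, R₁, hR₁, ?_⟩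
  intro S hS hgood η hη hηle R hR L w hLw Ψ hΨ hBI hfat htame
  obtain ⟨Ψ', hΨ', Q, σ, hd, h12, hL2, hii⟩ := hmain S hS hgood η hη hηle R hR L w hLw Ψ hΨ hBI hfat htame
  refine ⟨Ψ', hΨ', Q, σ, hd, hL2, ?_⟩
  intro x hx r hr hsub
  set F : ℝ := finavg (S ∩ ball x (2 * r)) (fun y => (σ y ^ 2) ^ d)
  have hF0 : 0 ≤ F := finavg_nonneg_of_nonneg fun y => Real.rpow_nonneg (sq_nonneg (σ y)) d
  set M : ℝ := F ^ (1 / d)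
  have hM0 : 0 ≤ M := Real.rpow_nonneg hF0 _
  have hAη : 0 ≤ A * η := mul_nonneg hA hη.le
  have hr2 : (0 : ℝ) < r ^ 2 := by positivity
  have hb1 : (0 : ℝ) ≤ 9 / 4 * c₁ * CKS := by positivity
  have hb2 : (0 : ℝ) ≤ 324 * CKS / κ := by positivity
  -- every branch bounds the left side by ONE of the three summands of `b` times `(M + A·η)`
  have hB : ∀ {t c : ℝ}, c ≤ 9 / 4 * c₁ * CKS + 324 * CKS / κ + N₀ ^ (1 / d) → t ≤ c * (M + A * η) →
      t ≤ (9 / 4 * c₁ * CKS + 324 * CKS / κ + N₀ ^ (1 / d)) * (M + A * η) :=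
    fun hc ht => ht.trans (mul_le_mul_of_nonneg_right hc (add_nonneg hM0 hAη))
  by_cases hsmall : r < r₀
  · -- SMALL balls: maximum over `B(x, 2r)` and packing
    have hsep : IsSep δ S := hS.isDoorSetP.2.1
    have hfin2 : (S ∩ ball x (2 * r)).Finite := finite_inter_ball_of_isSep hδ hsep x (2 * r)
    have hne2 : (S ∩ ball x (2 * r)).Nonempty := ⟨x, hx, mem_ball_self (by positivity)⟩
    obtain ⟨y, hy, hymax⟩ := (S ∩ ball x (2 * r)).exists_max_image (fun z => σ z ^ 2) hfin2 hne2
    have hm0 : 0 ≤ σ y ^ 2 := sq_nonneg _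
    have h1 : finavg (S ∩ ball x r) (fun z => σ z ^ 2) ≤ σ y ^ 2 :=
      finavg_le_of_le hm0 fun z hz => hymax z ⟨hz.1, ball_subset_ball (by linarith) hz.2⟩
    have hcard : ((S ∩ ball x (2 * r)).ncard : ℝ) ≤ N₀ :=
      (ncard_inter_ball_le_packing hδ hsep x (by positivity : (0 : ℝ) ≤ 2 * r)).trans (by rw [hN₀def]; gcongr)
    have hsum : (σ y ^ 2) ^ d ≤ ∑ᶠ z ∈ S ∩ ball x (2 * r), (σ z ^ 2) ^ d := by
      rw [finsum_mem_eq_finite_toFinset_sum _ hfin2]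
      exact Finset.single_le_sum (f := fun z => (σ z ^ 2) ^ d) (fun z _ => Real.rpow_nonneg (sq_nonneg (σ z)) d)
        (hfin2.mem_toFinset.2 hy)
    rw [finsum_mem_eq_ncard_mul_finavg hfin2 hne2] at hsum
    have hmd : (σ y ^ 2) ^ d ≤ N₀ * F := hsum.trans (mul_le_mul_of_nonneg_right hcard hF0)
    have h2 : ((σ y ^ 2) ^ d) ^ (1 / d) ≤ (N₀ * F) ^ (1 / d) := Real.rpow_le_rpow (Real.rpow_nonneg hm0 d) hmd (by positivity)
    rw [← Real.rpow_mul hm0, mul_one_div_cancel hd0.ne', Real.rpow_one, Real.mul_rpow hN₀0 hF0] at h2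
    refine hB (c := N₀ ^ (1 / d)) (by linarith) ?_
    calc finavg (S ∩ ball x r) (fun z => σ z ^ 2) ≤ σ y ^ 2 := h1
      _ ≤ N₀ ^ (1 / d) * M := h2
      _ ≤ N₀ ^ (1 / d) * (M + A * η) := mul_le_mul_of_nonneg_left (le_add_of_nonneg_right hAη) hb3
  · -- LARGE balls `r₀ ≤ r`: part UC's argument
    have hr₀r : r₀ ≤ r := not_lt.mp hsmall
    have hρ : (0 : ℝ) < 3 / 2 * r := by positivity
    have hball : ball x (4 / 3 * (3 / 2 * r)) = ball x (2 * r) := by congr 1; ring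
    have hsub' : S ∩ ball x (4 / 3 * (3 / 2 * r)) ⊆ ball 0 (8 * R) := by rw [hball]; exact hsub
    obtain ⟨U, v, hU, hks'⟩ := hks S hS.isDoorSetP hgood (8 * R) Ψ' Q σ hd x hx (3 / 2 * r) hρ hsub'
    rw [hball] at hks'
    by_cases hnear : finavg (S ∩ ball x (3 / 2 * r)) (fun p => ‖Ψ' p - (U p + v)‖ ^ 2) ≤ κ * r ^ 2
    · -- NEAR-rigid case: (ii♭) at `(U, v)`
      have h1 := hii x hx r hr hr₀r hsub U v hU hnear
      have hdiv : finavg (S ∩ ball x (3 / 2 * r)) (fun p => ‖Ψ' p - (U p + v)‖ ^ 2) / r ^ 2 ≤ CKS * (3 / 2 * r) ^ 2 * M / r ^ 2 :=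
        div_le_div_of_nonneg_right hks' hr2.le
      have hc₁b : c₁ * (A * η) ≤ 9 / 4 * c₁ * CKS * (A * η) := by
        refine mul_le_mul_of_nonneg_right ?_ hAη
        have := mul_le_mul_of_nonneg_left (show (1 : ℝ) ≤ 9 / 4 * CKS by linarith) hc₁.le
        linarith
      refine hB (c := 9 / 4 * c₁ * CKS) (by linarith) ?_
      calc finavg (S ∩ ball x r) (fun y => σ y ^ 2)
          ≤ c₁ * (finavg (S ∩ ball x (3 / 2 * r)) (fun p => ‖Ψ' p - (U p + v)‖ ^ 2) / r ^ 2 + A * η) := h1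
        _ ≤ c₁ * (CKS * (3 / 2 * r) ^ 2 * M / r ^ 2 + A * η) := mul_le_mul_of_nonneg_left (add_le_add hdiv le_rfl) hc₁.le
        _ = 9 / 4 * c₁ * CKS * M + c₁ * (A * η) := by
            field_simp
            ring
        _ ≤ 9 / 4 * c₁ * CKS * (M + A * η) := by linarith
    · -- FAR case: rigidity lower bound on `M` against `σ ≤ 12`
      have hfar : κ * r ^ 2 < 9 / 4 * CKS * M * r ^ 2 := by
        have hexp : CKS * (3 / 2 * r) ^ 2 * M = 9 / 4 * CKS * M * r ^ 2 := by ring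
        rw [← hexp]; exact lt_of_lt_of_le (not_le.mp hnear) hks'
      have hκM : κ < 9 / 4 * CKS * M := lt_of_mul_lt_mul_right hfar hr2.le
      have h144 : finavg (S ∩ ball x r) (fun y => σ y ^ 2) ≤ 144 := by
        refine finavg_le_of_le (by norm_num) fun y _ => ?_
        calc σ y ^ 2 ≤ 12 ^ 2 := pow_le_pow_left₀ (hd.2.1 y) (h12 y) 2
          _ = 144 := by norm_num
      refine hB (c := 324 * CKS / κ) (by linarith) ?_
      calc finavg (S ∩ ball x r) (fun y => σ y ^ 2) ≤ 144 := h144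
        _ ≤ 324 * CKS / κ * M := by
            rw [div_mul_eq_mul_div, le_div_iff₀ hκ]
            linarith
        _ ≤ 324 * CKS / κ * (M + A * η) := mul_le_mul_of_nonneg_left (le_add_of_nonneg_right hAη) hb2

/-! ### ZL.3  [CC°_Wᵇ] «CoherentGscCaccioppoliBPG» and the basin seam `[W] ∧ [CC°_Wᵇ] ⇒ [CC°ᵇ]` -/

/-- ★★ **[CC°_Wᵇ] «CoherentGscCaccioppoliBPG ϑ aHi Λ θ s»** — [CC°_W] `CoherentGscCaccioppoliPG` (part UD: [CC°] in the perturbative basin `(ϑ₁, ω₁)` of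
the prover's choice) VERBATIM with the extra hypothesis `IsBondIso S Ψ`; conclusion unchanged.  WEAKER than [CC°_W] and than [CC°ᵇ] (PROVED); with [W]
`CoherentWindowPG` (untouched: its conclusion is registration-free) it gives [CC°ᵇ] back (`tameGscCaccioppoliFloorBPG_of_coherent`).  THE MECHANISM-SIDE RESIDUAL
OF RECORD of line `_16XH19B(_tol)`.  MECHANISM-KNOWN-type (linearised lattice elasticity about the force-free equilibrium chart: Gårding + cut-off, Korn,
`UniformTameStability`) · GSC-priced by binder, driven by single-site force balance · UNDECIDED · ATTACKABLE·L.
Why it might fail: only through the typing, as [CC°_W] ((a) residual self-stress of the chart against the floor `A·η`; (b) `Ψ'` must be locally exact on coherent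
windows — the prover chooses it, and for a bond-isomorphic given `Ψ` the choice `Ψ' := Ψ` is available; (c) `r₀ ≥ 16`); not through faulted charts.
Sources: part UD ([CC°_W]: [giaquinta1984 Ch. III §1]; Ehrlacher–Ortner–Shapeev 2016 §§2–3; E–Ming 2007; Hudson–Ortner, arXiv 1304.5976; Braun–Schmidt,
arXiv 1604.01787); parts TG, UI. [this file, g52] -/
def CoherentGscCaccioppoliBPG (ϑ aHi Λ θ s : ℝ) : Prop :=
  ∀ δ : ℝ, 0 < δ → ∀ a : ℝ, 0 < a → ∀ Cg : ℝ, 1 ≤ Cg → ∃ Cg' : ℝ, Cg ≤ Cg' ∧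
    ∃ c₁ : ℝ, 0 < c₁ ∧ ∃ κ : ℝ, 0 < κ ∧ ∃ A : ℝ, 0 ≤ A ∧ ∃ r₀ : ℝ, 0 < r₀ ∧ ∃ ϑ₁ : ℝ, 0 < ϑ₁ ∧ ∃ ω₁ : ℝ, 0 < ω₁ ∧
    ∀ K₀ : ℝ, 0 < K₀ → ∃ η₁ : ℝ, 0 < η₁ ∧ ∃ R₁ : ℝ, 0 < R₁ ∧
      ∀ S : Set E3, IsDoorSetPG aHi δ S → (∀ q ∈ S, IsTwoShellAffineGood θ S q) →
        ∀ η : ℝ, 0 < η → η ≤ η₁ → ∀ R : ℝ, R₁ ≤ R →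
          ∀ (L : E3 ≃L[ℝ] E3) (w : ℤ → E3), IsEquilChart a s Λ L w →
            ∀ Ψ : E3 → E3, IsGlobalReg Cg η R S (LayeredHom (L : E3 →L[ℝ] E3) w) Ψ → IsBondIso S Ψ →
              K₀ ≤ η * nK (atomsIn (μS S) 0 R) →
                IsTameOn ϑ S (LayeredHom (L : E3 →L[ℝ] E3) w) (atomsIn (μS S) 0 (9 * R)) →
                IsCoherentOn ϑ₁ ω₁ S (LayeredHom (L : E3 →L[ℝ] E3) w) (atomsIn (μS S) 0 (9 * R)) →
                ∃ Ψ' : E3 → E3, IsGlobalReg Cg' η R S (LayeredHom (L : E3 →L[ℝ] E3) w) Ψ' ∧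
                  ∃ (Q : E3 → (E3 ≃ₗᵢ[ℝ] E3)) (σ : E3 → ℝ), IsTiltStrainData S (8 * R) Ψ' Q σ ∧ (∀ x, σ x ≤ 12) ∧
                    (∑ᶠ x ∈ atomsIn (μS S) 0 (8 * R), σ x ^ 2) ≤ A * η * nK (atomsIn (μS S) 0 (8 * R)) ∧
                    ∀ x ∈ S, ∀ r : ℝ, 0 < r → r₀ ≤ r → S ∩ ball x (2 * r) ⊆ ball 0 (8 * R) →
                      ∀ (U : E3 ≃ₗᵢ[ℝ] E3) (v : E3), LinearMap.det (U.toLinearEquiv : E3 →ₗ[ℝ] E3) = 1 →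
                        finavg (S ∩ ball x (3 / 2 * r)) (fun p => ‖Ψ' p - (U p + v)‖ ^ 2) ≤ κ * r ^ 2 →
                          finavg (S ∩ ball x r) (fun y => σ y ^ 2) ≤
                            c₁ * (finavg (S ∩ ball x (3 / 2 * r)) (fun p => ‖Ψ' p - (U p + v)‖ ^ 2) / r ^ 2 + A * η)

/-- **[CC°_W] ⇒ [CC°_Wᵇ] (PROVED)** — one more hypothesis. [this file, g52] -/
theorem coherentGscCaccioppoliBPG_of_coherentGscCaccioppoliPG {ϑ aHi Λ θ s : ℝ} (h : CoherentGscCaccioppoliPG ϑ aHi Λ θ s) :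
    CoherentGscCaccioppoliBPG ϑ aHi Λ θ s := by
  intro δ hδ a ha Cg hCg
  obtain ⟨Cg', hCg', c₁, hc₁, κ, hκ, A, hA, r₀, hr₀, ϑ₁, hϑ₁, ω₁, hω₁, hK⟩ := h δ hδ a ha Cg hCg
  refine ⟨Cg', hCg', c₁, hc₁, κ, hκ, A, hA, r₀, hr₀, ϑ₁, hϑ₁, ω₁, hω₁, fun K₀ hK₀ => ?_⟩
  obtain ⟨η₁, hη₁, R₁, hR₁, h1⟩ := hK K₀ hK₀
  exact ⟨η₁, hη₁, R₁, hR₁, fun S hS hgood η hη hηle R hR L w hLw Ψ hΨ _ hfat htame hcoh =>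
    h1 S hS hgood η hη hηle R hR L w hLw Ψ hΨ hfat htame hcoh⟩

/-- **[CC°ᵇ] ⇒ [CC°_Wᵇ] (PROVED)** — the basin side is WEAKER than [CC°ᵇ] (`ϑ₁ := ω₁ := 1`, the coherence hypothesis unused). [this file, g52] -/
theorem coherentGscCaccioppoliBPG_of_tameGscCaccioppoliFloorBPG {ϑ aHi Λ θ s : ℝ} (h : TameGscCaccioppoliFloorBPG ϑ aHi Λ θ s) :
    CoherentGscCaccioppoliBPG ϑ aHi Λ θ s := by
  intro δ hδ a ha Cg hCg
  obtain ⟨Cg', hCg', c₁, hc₁, κ, hκ, A, hA, r₀, hr₀, hK⟩ := h δ hδ a ha Cg hCg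
  refine ⟨Cg', hCg', c₁, hc₁, κ, hκ, A, hA, r₀, hr₀, 1, one_pos, 1, one_pos, fun K₀ hK₀ => ?_⟩
  obtain ⟨η₁, hη₁, R₁, hR₁, h1⟩ := hK K₀ hK₀
  exact ⟨η₁, hη₁, R₁, hR₁, fun S hS hgood η hη hηle R hR L w hLw Ψ hΨ hBI hfat htame _ =>
    h1 S hS hgood η hη hηle R hR L w hLw Ψ hΨ hBI hfat htame⟩

/-- ★★★ **SEAM (PROVED): `[W] ∧ [CC°_Wᵇ] ⇒ [CC°ᵇ]`** — part UD's `tameGscCaccioppoliFloorPG_of_coherent` (a tame fat near-flat window is `(ϑ₁, ω₁)`-coherent by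
[W] at the basin [CC°_Wᵇ] chose, then [CC°_Wᵇ] applies), the clause handed to [CC°_Wᵇ] only; thresholds `min/max`. [this file, g52] -/
theorem tameGscCaccioppoliFloorBPG_of_coherent {ϑ aHi Λ θ s : ℝ} (hW : CoherentWindowPG ϑ aHi Λ θ s)
    (hC : CoherentGscCaccioppoliBPG ϑ aHi Λ θ s) : TameGscCaccioppoliFloorBPG ϑ aHi Λ θ s := by
  intro δ hδ a ha Cg hCg
  obtain ⟨Cg', hCg', c₁, hc₁, κ, hκ, A, hA, r₀, hr₀, ϑ₁, hϑ₁, ω₁, hω₁, hK⟩ := hC δ hδ a ha Cg hCg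
  refine ⟨Cg', hCg', c₁, hc₁, κ, hκ, A, hA, r₀, hr₀, fun K₀ hK₀ => ?_⟩
  obtain ⟨η₁, hη₁, R₁, hR₁, h1⟩ := hW ϑ₁ hϑ₁ ω₁ hω₁ δ hδ a ha Cg hCg K₀ hK₀
  obtain ⟨η₁', hη₁', R₁', hR₁', h2⟩ := hK K₀ hK₀
  refine ⟨min η₁ η₁', lt_min hη₁ hη₁', max R₁ R₁', lt_max_of_lt_left hR₁, ?_⟩
  intro S hS hgood η hη hηle R hR L w hLw Ψ hΨ hBI hfat htame
  exact h2 S hS hgood η hη (hηle.trans (min_le_right _ _)) R ((le_max_right _ _).trans hR) L w hLw Ψ hΨ hBI hfat htame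
    (h1 S hS hgood η hη (hηle.trans (min_le_left _ _)) R ((le_max_left _ _).trans hR) L w hLw Ψ hΨ hfat htame)

/-! ### ZL.4  The lines down to [Cᵇ] and (Mᵇ); the docket of record -/

/-- ★★★ **COROLLARY (PROVED): the tame line down to [Cᵇ]** — `[Tᵇ] ∧ [KS] ∧ [CC°ᵇ] ⇒ [Cᵇ] RigidCaccioppoliBPG`. [this file, g52] -/
theorem rigidCaccioppoliBPG_of_tame_line {ϑ aHi Λ θ s : ℝ} (hT : TameWindowBPG ϑ aHi Λ θ s) (hKS : KornSobolevPoincareP aHi θ)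
    (hCC : TameGscCaccioppoliFloorBPG ϑ aHi Λ θ s) : RigidCaccioppoliBPG aHi Λ θ s :=
  rigidCaccioppoliBPG_of_tame hT (tameRigidCaccioppoliBPG_of_gscCaccioppoliFloor_of_kornSobolev hKS hCC)

/-- ★★★ **COROLLARY (PROVED): the coherent line down to [Cᵇ]** — `[Tᵇ] ∧ [KS] ∧ [W] ∧ [CC°_Wᵇ] ⇒ [Cᵇ]`. [this file, g52] -/
theorem rigidCaccioppoliBPG_of_coherent_line {ϑ aHi Λ θ s : ℝ} (hT : TameWindowBPG ϑ aHi Λ θ s) (hKS : KornSobolevPoincareP aHi θ)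
    (hW : CoherentWindowPG ϑ aHi Λ θ s) (hC : CoherentGscCaccioppoliBPG ϑ aHi Λ θ s) : RigidCaccioppoliBPG aHi Λ θ s :=
  rigidCaccioppoliBPG_of_tame_line hT hKS (tameGscCaccioppoliFloorBPG_of_coherent hW hC)

/-- ★★★ **COROLLARY (PROVED): the coherent line down to (Mᵇ)** — with the Gehring leaf (part UK):
`[Tᵇ] ∧ [KS] ∧ [W] ∧ [CC°_Wᵇ] ∧ leaf ⇒ StrainNonConcentrationBPG` (`aHi ≤ 8/7`). [this file, g52] -/
theorem strainNonConcentrationBPG_of_coherent_line {ϑ aHi Λ θ s : ℝ} (haHi : aHi ≤ 8 / 7) (hG : ZatorskaGoldstein2005_localGehringLemmaCounting)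
    (hT : TameWindowBPG ϑ aHi Λ θ s) (hKS : KornSobolevPoincareP aHi θ) (hW : CoherentWindowPG ϑ aHi Λ θ s)
    (hC : CoherentGscCaccioppoliBPG ϑ aHi Λ θ s) : StrainNonConcentrationBPG aHi Λ θ s :=
  strainNonConcentrationBPG_of_rigidCaccioppoliBPG haHi hG (rigidCaccioppoliBPG_of_coherent_line hT hKS hW hC)

/-- ★★★ **COROLLARY (PROVED): the dressed-core line down to (Mᵇ) = THE DOCKET OF RECORD** —
`[I_D] ∧ [T_bᵇ] ∧ [KS] ∧ [W] ∧ [CC°_Wᵇ] ∧ leaf ⇒ StrainNonConcentrationBPG` (`aHi ≤ 8/7`). [this file, g52] -/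
theorem strainNonConcentrationBPG_of_dressedCore_line {ϑ ϑe ωe : ℝ} {p : ℕ} {r₀ ℓ : ℝ} {M : ℕ} {aHi Λ θ s : ℝ} (haHi : aHi ≤ 8 / 7)
    (hG : ZatorskaGoldstein2005_localGehringLemmaCounting) (hI : DressedCorePG ϑ ϑe ωe p r₀ ℓ M aHi Λ θ s)
    (hTb : BareTameWindowBPG ϑ ϑe ωe p r₀ ℓ M aHi Λ θ s) (hKS : KornSobolevPoincareP aHi θ) (hW : CoherentWindowPG ϑ aHi Λ θ s)
    (hC : CoherentGscCaccioppoliBPG ϑ aHi Λ θ s) : StrainNonConcentrationBPG aHi Λ θ s :=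
  strainNonConcentrationBPG_of_coherent_line haHi hG (tameWindowBPG_of_dressedCore_of_bare hI hTb) hKS hW hC

/-- ★★★ **COROLLARY (PROVED): the clamped-core line down to (Mᵇ)** — `[CG] ∧ [T_bᵇ] ∧ [KS] ∧ [W] ∧ [CC°_Wᵇ] ∧ leaf ⇒ StrainNonConcentrationBPG`
(every clamp radius `ρ`; `aHi ≤ 8/7`). [this file, g52] -/
theorem strainNonConcentrationBPG_of_clampedCore_line {ϑ ϑe ωe : ℝ} {p : ℕ} {r₀ ℓ : ℝ} {M : ℕ} {ρ aHi Λ θ s : ℝ} (haHi : aHi ≤ 8 / 7)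
    (hG : ZatorskaGoldstein2005_localGehringLemmaCounting) (hI : ClampedCorePG ϑ ϑe ωe p r₀ ℓ M ρ aHi Λ θ s)
    (hTb : BareTameWindowBPG ϑ ϑe ωe p r₀ ℓ M aHi Λ θ s) (hKS : KornSobolevPoincareP aHi θ) (hW : CoherentWindowPG ϑ aHi Λ θ s)
    (hC : CoherentGscCaccioppoliBPG ϑ aHi Λ θ s) : StrainNonConcentrationBPG aHi Λ θ s :=
  strainNonConcentrationBPG_of_dressedCore_line haHi hG (dressedCorePG_of_clampedCorePG hI) hTb hKS hW hC

/-- ★★★ **THE DOCKET OF RECORD AT THE LITERALS (PROVED)** — `(Mᵇ) StrainNonConcentrationBPG 1 2 (1/16) (1/50)` (the leaf of part UI's column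
`gap_and_pert_1_50_of_certs_16XH19B(_tol)`) `⟸ Gehring-leaf ∧ [I_D] ∧ [T_bᵇ] ∧ [KS] ∧ [W] ∧ [CC°_Wᵇ]` at `(aHi; Λ, θ, s; ϑ; ϑe, ωe, p, r₀, ℓ, M) =
(1; 2, 1/16, 1/50; tameRadius; dressLevel, dressLevel, dressExponent, 8, collarRadius, clusterSize)`. [this file, g52] -/
theorem strainNonConcentrationBPG_1_50_of_docket (hG : ZatorskaGoldstein2005_localGehringLemmaCounting)
    (hI : DressedCorePG tameRadius dressLevel dressLevel dressExponent 8 collarRadius clusterSize 1 2 (1 / 16) (1 / 50))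
    (hTb : BareTameWindowBPG tameRadius dressLevel dressLevel dressExponent 8 collarRadius clusterSize 1 2 (1 / 16) (1 / 50))
    (hKS : KornSobolevPoincareP 1 (1 / 16)) (hW : CoherentWindowPG tameRadius 1 2 (1 / 16) (1 / 50))
    (hC : CoherentGscCaccioppoliBPG tameRadius 1 2 (1 / 16) (1 / 50)) : StrainNonConcentrationBPG 1 2 (1 / 16) (1 / 50) :=
  strainNonConcentrationBPG_of_dressedCore_line (by norm_num) hG hI hTb hKS hW hC

/-- Record example: the OLD docket `[I_D] ∧ [T_b] ∧ [KS] ∧ [W] ∧ [CC°_W]` (parts UG/UD, clause-free residuals) still closes the new leaf (Mᵇ) — nothing lost. -/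
example (hG : ZatorskaGoldstein2005_localGehringLemmaCounting)
    (hI : DressedCorePG tameRadius dressLevel dressLevel dressExponent 8 collarRadius clusterSize 1 2 (1 / 16) (1 / 50))
    (hTb : BareTameWindowPG tameRadius dressLevel dressLevel dressExponent 8 collarRadius clusterSize 1 2 (1 / 16) (1 / 50))
    (hKS : KornSobolevPoincareP 1 (1 / 16)) (hW : CoherentWindowPG tameRadius 1 2 (1 / 16) (1 / 50))
    (hC : CoherentGscCaccioppoliPG tameRadius 1 2 (1 / 16) (1 / 50)) : StrainNonConcentrationBPG 1 2 (1 / 16) (1 / 50) :=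
  strainNonConcentrationBPG_1_50_of_docket hG hI (bareTameWindowBPG_of_bareTameWindowPG hTb) hKS hW
    (coherentGscCaccioppoliBPG_of_coherentGscCaccioppoliPG hC)

/-- Record example: the clamped door [CG] at `ρ = clampRadius` (part UH) feeds the docket through [I_D]. -/
example (hG : ZatorskaGoldstein2005_localGehringLemmaCounting)
    (hI : ClampedCorePG tameRadius dressLevel dressLevel dressExponent 8 collarRadius clusterSize clampRadius 1 2 (1 / 16) (1 / 50))
    (hTb : BareTameWindowBPG tameRadius dressLevel dressLevel dressExponent 8 collarRadius clusterSize 1 2 (1 / 16) (1 / 50))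
    (hKS : KornSobolevPoincareP 1 (1 / 16)) (hW : CoherentWindowPG tameRadius 1 2 (1 / 16) (1 / 50))
    (hC : CoherentGscCaccioppoliBPG tameRadius 1 2 (1 / 16) (1 / 50)) : StrainNonConcentrationBPG 1 2 (1 / 16) (1 / 50) :=
  strainNonConcentrationBPG_of_clampedCore_line (by norm_num) hG hI hTb hKS hW hC

end Summit.AtomisticToContinuum.Crystallization.Theorems.ChartedZeroExcessLayeredLatticeLiouville

end
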